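import Literature.AnabelianGeometry.SemiGraphs.ArithTemperedGroupLevelTopology
import HarnessLib

/-!
# [SemiAnbd] Prop 5.2 (iv) / Thm 5.4 (i): the tempered level topology of `π₁^temp(𝒢) ⋊^out Π_A` —
# canonicity of the named term and the compactness transfer along `ι` and `aug`

Mochizuki, *Semi-graphs of anabelioids*, Publ. RIMS **42** (2006), Prop 5.2 (iv) p. 64, Thm 5.4 (i) p. 66
(the statement concerns COMPACT subgroups of `Π^temp_𝔊`; its proof moves them to `Π_A` along `aug` and meets
them with `Π^temp_𝒢` along `ι`) [cite: MochizukiSemiAnbd2006, Thm 5.4 (i), p. 66].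

PROOF-ONLY companion of `ArithTemperedGroupLevelTopology.lean` (abc-iut cell, producer row T54-B, sub-row
«T54·E-top», seat abc-iut-w6-d070):

* `arithLevelTopology_unique` — CANONICITY of the `Exists.choose`: any group topology on
  `π₁^temp(𝒢) ⋊^out Π_A` with the same basis `levelKer (N n) ⊓ aug⁻¹U` of `𝓝 1` IS `arithLevelTopology`
  (a group topology is determined by `𝓝 1`; lemma and proof = the RQ7 kernel probe of abc-iut-w4-d066 on
  p431501, adopted verbatim as offered);
* `isClosedEmbedding_toOuterSemidirectProduct` — `ι` is a CLOSED embedding (embedding + closed range);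
* `isCompact_preimage_toOuterSemidirectProduct` — compact subsets of `π₁^temp(𝒢) ⋊^out Π_A` meet
  `π₁^temp(𝒢)` in compact subsets (the shape in which the capstone's compact `C ≤ Π^temp_𝔊` are handed to
  the geometric [SemiAnbd] Thm 3.7 (iii) machinery, binder `hnobpNCpt`);
* `isCompact_image_outerSemidirectProductSnd` — and map to compact subsets of `Π_A` (binder
  `stabBranchPairAug` / (AI4″)).

No definition, no instance, no named fact; binders = those of `arithLevelTopology`.  Nothing here refers to
the IUT corpus beyond the producer row; no side is taken on [IUTchIII] Cor 3.12; typed ≠ proved.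
-/

namespace Literature.AnabelianGeometry.SemiGraphs

namespace ProfiniteSemiGraph

open CategoryTheory Topology Filter
open Literature.AnabelianGeometry.EtaleTheta

universe u

variable {𝒢 : ProfiniteSemiGraph.{u}} (c : TemperedPiChart 𝒢)
  {PA : Type u} [Group PA] [TopologicalSpace PA] [IsTopologicalGroup PA]
  (ρ : PA →* TopOut c.G) (baseAct : PA →* Aut 𝒢.graph)

section Compact

variable [FirstCountableTopology c.G]
  (h36 : 𝒢.Prop36Hypotheses) (hA : IsTempered PA)
  (P : SemiGraph.SubgroupPresentation 𝒢.graph c.G)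
  (hP : P.IsArithCompatible
    (((contMulAut c.G).subtype.comp (MonoidHom.fst (contMulAut c.G) PA)).comp
      (outerSemidirectProduct ρ).subtype)
    (baseAct.comp (outerSemidirectProductSnd ρ)))
  (w₀ : 𝒢.graph.Vertex) (hcpt : IsCompact (P.H w₀ : Set c.G))
  (N : ℕ → Subgroup c.G) (hNn : ∀ n, (N n).Normal)
  (hNst : ∀ (n : ℕ) (e : outerSemidirectProduct ρ) (x : c.G), x ∈ N n →
    (((contMulAut c.G).subtype.comp (MonoidHom.fst (contMulAut c.G) PA)).comp
      (outerSemidirectProduct ρ).subtype) e x ∈ N n)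
  (hNanti : Antitone N) (hNopen : ∀ n, IsOpen (N n : Set c.G))
  (hNcof : ∀ U ∈ 𝓝 (1 : c.G), ∃ n, (N n : Set c.G) ⊆ U)
  (hK1' : ∀ n, IsOpen (((P.levelKer hP (N n) (hNst n)).map (outerSemidirectProductSnd ρ) :
    Subgroup PA) : Set PA))

include h36 hA hcpt hNn hNanti hNopen hNcof hK1'

/-- **Canonicity of `arithLevelTopology`**: any group topology on `π₁^temp(𝒢) ⋊^out Π_A` whose
neighbourhood filter of `1` has the basis `levelKer (N n) ⊓ aug⁻¹U` (`n : ℕ`, `U ⊴ Π_A` open normal) IS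
`arithLevelTopology` — a group topology is determined by `𝓝 1`, so the `Exists.choose` chose nothing.
(Lemma and proof from the RQ7 kernel probe of abc-iut-w4-d066 on p431501.)
[cite: MochizukiSemiAnbd2006, Prop 5.2 (iv), p. 64] -/
theorem arithLevelTopology_unique (τ : TopologicalSpace (outerSemidirectProduct ρ))
    (hτ : @IsTopologicalGroup (outerSemidirectProduct ρ) τ _)
    (hb : (@nhds _ τ 1).HasBasis (fun _ : ℕ × OpenNormalSubgroup PA => True)
      (fun nU => ((P.levelKer hP (N nU.1) (hNst nU.1) ⊓
        nU.2.toSubgroup.comap (outerSemidirectProductSnd ρ) :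
          Subgroup (outerSemidirectProduct ρ)) : Set (outerSemidirectProduct ρ)))) :
    τ = arithLevelTopology c ρ baseAct h36 hA P hP w₀ hcpt N hNn hNst hNanti hNopen hNcof hK1' :=
  IsTopologicalGroup.ext hτ
    (arithLevelTopology_isTopologicalGroup c ρ baseAct h36 hA P hP w₀ hcpt N hNn hNst hNanti hNopen hNcof hK1')
    (hb.eq_of_same_basis
      (arithLevelTopology_nhds_hasBasis c ρ baseAct h36 hA P hP w₀ hcpt N hNn hNst hNanti hNopen hNcof hK1'))

/-- `ι : π₁^temp(𝒢) → π₁^temp(𝒢) ⋊^out Π_A` is a CLOSED EMBEDDING for `arithLevelTopology`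
([SemiAnbd] Prop 5.2 (iv): `Π^temp_𝒢` is a closed normal subgroup of `Π^temp_𝔊`).
[cite: MochizukiSemiAnbd2006, Prop 5.2 (iv), p. 64] -/
theorem isClosedEmbedding_toOuterSemidirectProduct :
    @IsClosedEmbedding _ _ _ (arithLevelTopology c ρ baseAct h36 hA P hP w₀ hcpt N hNn hNst hNanti hNopen hNcof
      hK1') (toOuterSemidirectProduct ρ) := by
  letI := arithLevelTopology c ρ baseAct h36 hA P hP w₀ hcpt N hNn hNst hNanti hNopen hNcof hK1'
  exact ⟨isEmbedding_toOuterSemidirectProduct c ρ baseAct h36 hA P hP w₀ hcpt N hNn hNst hNanti hNopen hNcof hK1',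
    isClosed_range_toOuterSemidirectProduct c ρ baseAct h36 hA P hP w₀ hcpt N hNn hNst hNanti hNopen hNcof hK1'⟩

/-- **Compact subsets of `π₁^temp(𝒢) ⋊^out Π_A` meet `π₁^temp(𝒢)` in compact subsets**: the preimage
under `ι` of a compact set is compact (`ι` is a closed embedding) — the shape in which a compact
`C ≤ Π^temp_𝔊` of Thm 5.4 (i) is handed to the geometric Thm 3.7 (iii) machinery.
[cite: MochizukiSemiAnbd2006, Thm 5.4 (i), p. 66] -/
theorem isCompact_preimage_toOuterSemidirectProduct {K : Set (outerSemidirectProduct ρ)}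
    (hK : @IsCompact _ (arithLevelTopology c ρ baseAct h36 hA P hP w₀ hcpt N hNn hNst hNanti hNopen hNcof hK1') K) :
    IsCompact (toOuterSemidirectProduct ρ ⁻¹' K) := by
  letI := arithLevelTopology c ρ baseAct h36 hA P hP w₀ hcpt N hNn hNst hNanti hNopen hNcof hK1'
  exact (isClosedEmbedding_toOuterSemidirectProduct c ρ baseAct h36 hA P hP w₀ hcpt N hNn hNst hNanti hNopen
    hNcof hK1').isCompact_preimage hK

/-- **Compact subsets of `π₁^temp(𝒢) ⋊^out Π_A` map to compact subsets of `Π_A`** (`aug` is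
continuous) — the shape in which a compact `C ≤ Π^temp_𝔊` of Thm 5.4 (i) acts on the base `A`-side.
[cite: MochizukiSemiAnbd2006, Thm 5.4 (i), p. 66] -/
theorem isCompact_image_outerSemidirectProductSnd {K : Set (outerSemidirectProduct ρ)}
    (hK : @IsCompact _ (arithLevelTopology c ρ baseAct h36 hA P hP w₀ hcpt N hNn hNst hNanti hNopen hNcof hK1') K) :
    IsCompact (outerSemidirectProductSnd ρ '' K) := by
  letI := arithLevelTopology c ρ baseAct h36 hA P hP w₀ hcpt N hNn hNst hNanti hNopen hNcof hK1'
  exact hK.image (continuous_outerSemidirectProductSnd c ρ baseAct h36 hA P hP w₀ hcpt N hNn hNst hNanti hNopen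
    hNcof hK1')

/-- A compact SUBGROUP `C ≤ π₁^temp(𝒢) ⋊^out Π_A` has compact image subgroup `aug(C) ≤ Π_A`.
[cite: MochizukiSemiAnbd2006, Thm 5.4 (i), p. 66] -/
theorem isCompact_map_outerSemidirectProductSnd {C : Subgroup (outerSemidirectProduct ρ)}
    (hC : @IsCompact _ (arithLevelTopology c ρ baseAct h36 hA P hP w₀ hcpt N hNn hNst hNanti hNopen hNcof hK1')
      (C : Set (outerSemidirectProduct ρ))) :
    IsCompact ((C.map (outerSemidirectProductSnd ρ) : Subgroup PA) : Set PA) := by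
  rw [Subgroup.coe_map]
  exact isCompact_image_outerSemidirectProductSnd c ρ baseAct h36 hA P hP w₀ hcpt N hNn hNst hNanti hNopen hNcof
    hK1' hC

/-- A compact SUBGROUP `C ≤ π₁^temp(𝒢) ⋊^out Π_A` has compact trace `ι⁻¹(C) ≤ π₁^temp(𝒢)`.
[cite: MochizukiSemiAnbd2006, Thm 5.4 (i), p. 66] -/
theorem isCompact_comap_toOuterSemidirectProduct {C : Subgroup (outerSemidirectProduct ρ)}
    (hC : @IsCompact _ (arithLevelTopology c ρ baseAct h36 hA P hP w₀ hcpt N hNn hNst hNanti hNopen hNcof hK1')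
      (C : Set (outerSemidirectProduct ρ))) :
    IsCompact ((C.comap (toOuterSemidirectProduct ρ) : Subgroup c.G) : Set c.G) := by
  rw [Subgroup.coe_comap]
  exact isCompact_preimage_toOuterSemidirectProduct c ρ baseAct h36 hA P hP w₀ hcpt N hNn hNst hNanti hNopen
    hNcof hK1' hC

end Compact

end ProfiniteSemiGraph

end Literature.AnabelianGeometry.SemiGraphs
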